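import Mathlib
import Literature.Computability.Complexity.Circuit
import Literature.Computability.Complexity.CircuitComposition
import Literature.Computability.Complexity.NegationElimination
import HarnessLib

/-!
# Composition of straight-line formulas (binary connectives, iterated `∧` / `∨`)

`Literature/Computability/Complexity/CircuitComposition.lean` composes straight-line *circuits*
(`CktSize`), without tracking the formula property `Circuit.IsFormula` (every gate referenced at
most once). This file provides the small amount of bookkeeping needed to build *formulas*
compositionally in the tree's model `Literature.Computability.Complexity.Circuit`:

* `Circuit.binop op C₁ C₂` — the gates of `C₁`, then those of `C₂` relocated behind them
  (`GateList.reloc`), then one binary gate `op` reading the two outputs; `eval_binop`,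
  `isOver_binop`, `size_binop`;
* the invariant propagated is "*clean formula*": `IsFormula` together with "the output gate is
  referenced by no gate" (a formula in the sense of `IsFormula` may have its output gate read by a
  dangling gate, and then feeding the output into a new gate would break the formula property);
  `refCount_binop` computes the reference counts of `binop` exactly and `isFormula_binop` propagates
  the invariant; `isFormula_input` starts it;
* `Circuit.bigAnd k F`, `Circuit.bigOr k F` — iterated conjunction / disjunction of `k + 1`
  formulas (right combs of `binop` with the truth tables `(GateFn.and 2).2`, `(GateFn.or 2).2`,
  so that the new gates are literally the `GateList.andGate` / `orGate` of
  `NegationElimination.lean`), with `eval_bigAnd : eval = decide (∀ i, (F i).eval x)`,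
  `eval_bigOr`, basis and clean-formula lemmas. Empty conjunctions are deliberately not provided
  (no constants over the monotone basis `{∧₂, ∨₂}`). Evaluation goes through
  `GateList.circuit_eval` / `vals_append_reloc`.

Used to show that concrete monotone functions (e.g. `¬OV`, a conjunction of disjunctions of
conjunctions of two variables) do have monotone formulas, so that `formulaSizeOver monotoneBasis`
is an attained minimum rather than the junk value `0`
(`Literature/Computability/FineGrained/MonotoneOV.lean`).

## References

* [Vollmer1999] H. Vollmer, *Introduction to Circuit Complexity* (1999), §1.2 (composition of
  circuits; formulas as fan-out-one circuits).
* [Jukna2012] S. Jukna, *Boolean Function Complexity* (2012), §1.2 (formulas over a basis).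
-/

namespace Literature.Computability.Complexity

open Finset GateList

variable {ι : Type*}

/-! ### Reference counts of single gates -/

namespace Gate

/-- The number of argument positions of the gate `g` wired to gate `m` (so that
`C.refCount m = Σ_{g ∈ C.gates} g.slotCount m`). [cite: Jukna2012, §1.2] -/
def slotCount (m : ℕ) (g : Gate ι) : ℕ :=
  (univ.filter fun a : Fin g.arity => (g.args a).getRight? = some m).card

/-- Relocating a gate behind `L` gates (inputs kept as inputs) shifts the gates it references by
`L`. [folklore] -/
theorem slotCount_reloc_inl (m L : ℕ) (g : Gate ι) :
    (reloc (fun i => (Sum.inl i : ι ⊕ ℕ)) L g).slotCount m =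
      if L ≤ m then g.slotCount (m - L) else 0 := by
  have key : ∀ a : Fin g.arity,
      ((reloc (fun i => (Sum.inl i : ι ⊕ ℕ)) L g).args a).getRight? = some m ↔
        L ≤ m ∧ (g.args a).getRight? = some (m - L) := by
    intro a
    change (shiftWire (fun i => (Sum.inl i : ι ⊕ ℕ)) L (g.args a)).getRight? = some m ↔ _
    cases g.args a with
    | inl i => simp [shiftWire]
    | inr m' =>
      simp only [shiftWire, Sum.getRight?_inr, Option.some.injEq]
      omega
  unfold slotCount
  split_ifs with h
  · exact congrArg Finset.card (Finset.filter_congr fun a _ => (key a).trans (and_iff_right h))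
  · rw [card_eq_zero, filter_eq_empty_iff]
    intro a _ ha
    exact h ((key a).1 ha).1

/-- The reference contributions of a binary gate with argument wires `u, v`. [folklore] -/
theorem slotCount_mk_two (m : ℕ) (op : (Fin 2 → Bool) → Bool) (u v : ι ⊕ ℕ) :
    slotCount m (⟨2, op, ![u, v]⟩ : Gate ι) =
      (if u.getRight? = some m then 1 else 0) + (if v.getRight? = some m then 1 else 0) := by
  unfold slotCount
  rw [card_filter, Fin.sum_univ_two]
  simp only [Matrix.cons_val_zero, Matrix.cons_val_one]
  split_ifs <;> rfl

end Gate

namespace Circuit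

/-- `refCount` as a sum of `slotCount`s (definitional). [folklore] -/
theorem refCount_eq_sum_slotCount (C : Circuit ι) (m : ℕ) :
    C.refCount m = (C.gates.map (Gate.slotCount m)).sum := rfl

/-- Gates at or beyond the end of the program are referenced by nobody (acyclicity). [folklore] -/
theorem refCount_eq_zero_of_le (C : Circuit ι) {m : ℕ} (hm : C.gates.length ≤ m) :
    C.refCount m = 0 := by
  rw [refCount_eq_sum_slotCount]
  apply List.sum_eq_zero
  intro c hc
  rw [List.mem_map] at hc
  obtain ⟨g, hg, rfl⟩ := hc
  obtain ⟨p, hp, rfl⟩ := List.mem_iff_getElem.1 hg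
  unfold Gate.slotCount
  rw [card_eq_zero, filter_eq_empty_iff]
  intro a _ ha
  rw [Sum.getRight?_eq_some_iff] at ha
  have := C.wf p hp a m ha
  omega

/-! ### The input formula -/

/-- The gate-free circuit `input i` is a clean formula. [folklore] -/
theorem isFormula_input (i : ι) :
    (input i : Circuit ι).IsFormula ∧ ∀ m, (input i : Circuit ι).output = .inr m →
      (input i : Circuit ι).refCount m = 0 :=
  ⟨fun m => by simp [refCount, input], fun m h => by simp [input] at h⟩

/-- The input formula is over every basis (it has no gates). [folklore] -/
theorem isOver_input (B : Set GateFn) (i : ι) : (input i : Circuit ι).IsOver B :=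
  fun g hg => by simp [input] at hg

/-! ### One binary connective on top of two formulas -/

/-- **`C₁ ⋄ C₂`**: the gates of `C₁`, the gates of `C₂` relocated behind them, and a final binary
gate `op` reading the two output wires (Vollmer 1999, §1.2, composition). [cite: Vollmer1999, §1.2] -/
def binop (op : (Fin 2 → Bool) → Bool) (C₁ C₂ : Circuit ι) : Circuit ι where
  gates := C₁.gates ++ C₂.gates.map (reloc (fun i => (Sum.inl i : ι ⊕ ℕ)) C₁.gates.length) ++
    [⟨2, op, ![C₁.output, shiftWire (fun i => (Sum.inl i : ι ⊕ ℕ)) C₁.gates.length C₂.output]⟩]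
  output := .inr (C₁.gates.length + C₂.gates.length)
  wf := by
    have hρ : WiresOK C₁.gates.length (fun i => (Sum.inl i : ι ⊕ ℕ)) := wiresOK_inl _ _root_.id
    have hW : WF (C₁.gates ++ C₂.gates.map (reloc (fun i => (Sum.inl i : ι ⊕ ℕ)) C₁.gates.length) ++
        [⟨2, op, ![C₁.output,
          shiftWire (fun i => (Sum.inl i : ι ⊕ ℕ)) C₁.gates.length C₂.output]⟩]) := by
      refine ((wf_gates C₁).append_reloc (wf_gates C₂) hρ).append_singleton ?_
      intro a m ha
      simp only [List.length_append, List.length_map]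
      revert ha
      refine Fin.cases ?_ (fun a => ?_) a
      · intro ha
        simp only [Matrix.cons_val_zero] at ha
        have := C₁.wf_output m ha
        omega
      · intro ha
        have ha' : shiftWire (fun i => (Sum.inl i : ι ⊕ ℕ)) C₁.gates.length C₂.output = .inr m := by
          simpa using ha
        cases hco : C₂.output with
        | inl i => rw [hco] at ha'; simp [shiftWire] at ha'
        | inr m' =>
          rw [hco] at ha'
          simp only [shiftWire, Sum.inr.injEq] at ha'
          have := C₂.wf_output m' hco
          omega
    intro j hj a m ha
    exact hW j _ (List.getElem?_eq_getElem hj) a m ha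
  wf_output := by
    intro m hm
    simp only [Sum.inr.injEq] at hm
    subst hm
    simp

/-- Size of `C₁ ⋄ C₂`. [folklore] -/
@[simp] theorem size_binop (op : (Fin 2 → Bool) → Bool) (C₁ C₂ : Circuit ι) :
    (binop op C₁ C₂).size = C₁.size + C₂.size + 1 := by
  simp [binop, size, Nat.add_assoc]

/-- **`C₁ ⋄ C₂` computes `op (C₁, C₂)`** (Vollmer 1999, §1.2). [cite: Vollmer1999, §1.2] -/
theorem eval_binop (op : (Fin 2 → Bool) → Bool) (C₁ C₂ : Circuit ι) (x : ι → Bool) :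
    (binop op C₁ C₂).eval x = op ![C₁.eval x, C₂.eval x] := by
  have hρ : WiresOK C₁.gates.length (fun i => (Sum.inl i : ι ⊕ ℕ)) := wiresOK_inl _ _root_.id
  rw [circuit_eval]
  change wireOf x (vals (C₁.gates ++ C₂.gates.map (reloc (fun i => (Sum.inl i : ι ⊕ ℕ))
      C₁.gates.length) ++ [⟨2, op, ![C₁.output,
        shiftWire (fun i => (Sum.inl i : ι ⊕ ℕ)) C₁.gates.length C₂.output]⟩]) x)
    (.inr (C₁.gates.length + C₂.gates.length)) = _
  rw [vals_append_singleton, vals_append_reloc _ _ _ hρ]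
  simp only [wireOf_inl]
  have hlen : (vals C₁.gates x ++ vals C₂.gates x).length = C₁.gates.length + C₂.gates.length := by
    simp
  rw [wireOf_inr, List.getD_eq_getElem?_getD, List.getElem?_append_right hlen.le, hlen, Nat.sub_self]
  simp only [List.getElem?_cons_zero, Option.getD_some]
  congr 1
  funext a
  refine Fin.cases ?_ (fun a => ?_) a
  · simp only [Matrix.cons_val_zero]
    rw [wireOf_append_of_lt _ _ _ _ (fun m hm =>
      (length_vals C₁.gates x).symm ▸ C₁.wf_output m hm), ← circuit_eval]
  · have ha : a = 0 := Fin.fin_one_eq_zero a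
    subst ha
    simp only [Matrix.cons_val_succ, Matrix.cons_val_fin_one]
    rw [wireOf_shiftWire x _ _ (length_vals C₁.gates x) _ hρ]
    simp only [wireOf_inl]
    rw [← circuit_eval]

/-- `C₁ ⋄ C₂` is over any basis containing `⋄` and the gates of `C₁, C₂`. [cite: Vollmer1999, §1.2] -/
theorem isOver_binop {B : Set GateFn} {op : (Fin 2 → Bool) → Bool} (hop : (⟨2, op⟩ : GateFn) ∈ B)
    {C₁ C₂ : Circuit ι} (h₁ : C₁.IsOver B) (h₂ : C₂.IsOver B) : (binop op C₁ C₂).IsOver B := by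
  intro g hg
  simp only [binop, List.mem_append, List.mem_map, List.mem_singleton] at hg
  rcases hg with (hg | ⟨g', hg', rfl⟩) | rfl
  · exact h₁ g hg
  · rw [reloc_fn]; exact h₂ g' hg'
  · exact hop

/-- **Reference counts of `C₁ ⋄ C₂`**: those of `C₁`, those of `C₂` shifted, plus the two
references made by the new gate. [folklore] -/
theorem refCount_binop (op : (Fin 2 → Bool) → Bool) (C₁ C₂ : Circuit ι) (m : ℕ) :
    (binop op C₁ C₂).refCount m =
      C₁.refCount m + (if C₁.gates.length ≤ m then C₂.refCount (m - C₁.gates.length) else 0) +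
        ((if C₁.output.getRight? = some m then 1 else 0) +
          (if (shiftWire (fun i => (Sum.inl i : ι ⊕ ℕ)) C₁.gates.length C₂.output).getRight? =
              some m then 1 else 0)) := by
  rw [← Gate.slotCount_mk_two]
  simp only [refCount_eq_sum_slotCount, binop, List.map_append, List.sum_append, List.map_map,
    List.map_cons, List.map_nil, List.sum_cons, List.sum_nil, add_zero]
  congr 2
  simp only [Function.comp_def, Gate.slotCount_reloc_inl]
  split_ifs with h
  · rfl
  · simp

/-- **`⋄` preserves clean formulas**: if `C₁, C₂` are formulas whose output gates are unreferenced,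
so is `C₁ ⋄ C₂` (Vollmer 1999, §1.2: formulas are the fan-out-`1` circuits). [cite: Vollmer1999, §1.2] -/
theorem isFormula_binop (op : (Fin 2 → Bool) → Bool) {C₁ C₂ : Circuit ι} (hF₁ : C₁.IsFormula)
    (hc₁ : ∀ m, C₁.output = .inr m → C₁.refCount m = 0) (hF₂ : C₂.IsFormula)
    (hc₂ : ∀ m, C₂.output = .inr m → C₂.refCount m = 0) :
    (binop op C₁ C₂).IsFormula ∧
      ∀ m, (binop op C₁ C₂).output = .inr m → (binop op C₁ C₂).refCount m = 0 := by
  have key : ∀ m, (binop op C₁ C₂).refCount m ≤ 1 ∧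
      (C₁.gates.length + C₂.gates.length ≤ m → (binop op C₁ C₂).refCount m = 0) := by
    intro m
    rw [refCount_binop]
    by_cases hLm : C₁.gates.length ≤ m
    · rw [if_pos hLm, C₁.refCount_eq_zero_of_le hLm]
      have h1 : ¬ C₁.output.getRight? = some m := fun h =>
        absurd (C₁.wf_output m (Sum.getRight?_eq_some_iff.1 h)) (not_lt.2 hLm)
      rw [if_neg h1]
      have h2 : (shiftWire (fun i => (Sum.inl i : ι ⊕ ℕ)) C₁.gates.length C₂.output).getRight? =
          some m ↔ C₂.output = .inr (m - C₁.gates.length) := by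
        cases hco : C₂.output with
        | inl i => simp [shiftWire]
        | inr m' =>
          simp only [shiftWire, Sum.getRight?_inr, Option.some.injEq, Sum.inr.injEq]
          omega
      by_cases h3 : C₂.output = .inr (m - C₁.gates.length)
      · rw [if_pos (h2.2 h3), hc₂ _ h3]
        have := C₂.wf_output _ h3
        exact ⟨by simp, fun hm => by omega⟩
      · rw [if_neg (fun h => h3 (h2.1 h))]
        refine ⟨by simpa using hF₂ (m - C₁.gates.length), fun hm => ?_⟩
        simp [C₂.refCount_eq_zero_of_le (show C₂.gates.length ≤ m - C₁.gates.length by omega)]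
    · rw [if_neg hLm]
      have h2 : ¬ (shiftWire (fun i => (Sum.inl i : ι ⊕ ℕ)) C₁.gates.length C₂.output).getRight? =
          some m := by
        cases hco : C₂.output with
        | inl i => simp [shiftWire]
        | inr m' =>
          simp only [shiftWire, Sum.getRight?_inr, Option.some.injEq]
          omega
      rw [if_neg h2]
      by_cases h1 : C₁.output = .inr m
      · rw [if_pos (Sum.getRight?_eq_some_iff.2 h1), hc₁ m h1]
        exact ⟨by simp, fun hm => by omega⟩
      · rw [if_neg (fun h => h1 (Sum.getRight?_eq_some_iff.1 h))]
        exact ⟨by simpa using hF₁ m, fun hm => by omega⟩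
  refine ⟨fun m => (key m).1, fun m hm => ?_⟩
  simp only [binop, Sum.inr.injEq] at hm
  exact (key m).2 hm.le

/-! ### Iterated conjunction and disjunction -/

/-- `∧₂` on a pair of values. [folklore] -/
@[simp] theorem and_two_apply_pair (a b : Bool) : (GateFn.and 2).2 ![a, b] = (a && b) := by
  simp [GateFn.and, Fin.forall_fin_two]

/-- `∨₂` on a pair of values. [folklore] -/
@[simp] theorem or_two_apply_pair (a b : Bool) : (GateFn.or 2).2 ![a, b] = (a || b) := by
  simp [GateFn.or, Fin.exists_fin_two]

/-- `∧₂`, as the pair (arity, truth table), lies in `{∧₂, ∨₂}`. [folklore] -/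
theorem and_two_mem_monotoneBasis : (⟨2, (GateFn.and 2).2⟩ : GateFn) ∈ monotoneBasis :=
  and_mem_monotoneBasis

/-- `∨₂`, as the pair (arity, truth table), lies in `{∧₂, ∨₂}`. [folklore] -/
theorem or_two_mem_monotoneBasis : (⟨2, (GateFn.or 2).2⟩ : GateFn) ∈ monotoneBasis :=
  or_mem_monotoneBasis

/-- **Iterated conjunction** `F 0 ∧ (F 1 ∧ (… ∧ F k))` of `k + 1` formulas. [cite: Jukna2012, §1.2] -/
def bigAnd : (k : ℕ) → (Fin (k + 1) → Circuit ι) → Circuit ι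
  | 0, F => F 0
  | k + 1, F => binop (GateFn.and 2).2 (F 0) (bigAnd k fun i => F i.succ)

/-- **Iterated disjunction** `F 0 ∨ (F 1 ∨ (… ∨ F k))` of `k + 1` formulas. [cite: Jukna2012, §1.2] -/
def bigOr : (k : ℕ) → (Fin (k + 1) → Circuit ι) → Circuit ι
  | 0, F => F 0
  | k + 1, F => binop (GateFn.or 2).2 (F 0) (bigOr k fun i => F i.succ)

/-- The iterated conjunction computes the conjunction. [folklore] -/
theorem eval_bigAnd : ∀ (k : ℕ) (F : Fin (k + 1) → Circuit ι) (x : ι → Bool),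
    (bigAnd k F).eval x = decide (∀ i, (F i).eval x = true)
  | 0, F, x => by simp [bigAnd, Fin.forall_fin_one]
  | k + 1, F, x => by
    rw [bigAnd, eval_binop, and_two_apply_pair, eval_bigAnd k]
    simp [Fin.forall_fin_succ (P := fun i => (F i).eval x = true)]

/-- The iterated disjunction computes the disjunction. [folklore] -/
theorem eval_bigOr : ∀ (k : ℕ) (F : Fin (k + 1) → Circuit ι) (x : ι → Bool),
    (bigOr k F).eval x = decide (∃ i, (F i).eval x = true)
  | 0, F, x => by simp [bigOr, Fin.exists_fin_one]
  | k + 1, F, x => by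
    rw [bigOr, eval_binop, or_two_apply_pair, eval_bigOr k]
    simp [Fin.exists_fin_succ (P := fun i => (F i).eval x = true)]

/-- The iterated conjunction stays inside any basis containing `∧₂`. [folklore] -/
theorem isOver_bigAnd {B : Set GateFn} (hB : (⟨2, (GateFn.and 2).2⟩ : GateFn) ∈ B) :
    ∀ (k : ℕ) (F : Fin (k + 1) → Circuit ι), (∀ i, (F i).IsOver B) → (bigAnd k F).IsOver B
  | 0, _, h => h 0
  | k + 1, _, h => isOver_binop hB (h 0) (isOver_bigAnd hB k _ fun i => h i.succ)

/-- The iterated disjunction stays inside any basis containing `∨₂`. [folklore] -/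
theorem isOver_bigOr {B : Set GateFn} (hB : (⟨2, (GateFn.or 2).2⟩ : GateFn) ∈ B) :
    ∀ (k : ℕ) (F : Fin (k + 1) → Circuit ι), (∀ i, (F i).IsOver B) → (bigOr k F).IsOver B
  | 0, _, h => h 0
  | k + 1, _, h => isOver_binop hB (h 0) (isOver_bigOr hB k _ fun i => h i.succ)

/-- The iterated conjunction of clean formulas is a clean formula. [folklore] -/
theorem isFormula_bigAnd : ∀ (k : ℕ) (F : Fin (k + 1) → Circuit ι),
    (∀ i, (F i).IsFormula ∧ ∀ m, (F i).output = .inr m → (F i).refCount m = 0) →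
      (bigAnd k F).IsFormula ∧ ∀ m, (bigAnd k F).output = .inr m → (bigAnd k F).refCount m = 0
  | 0, _, h => h 0
  | k + 1, F, h => by
    have ih := isFormula_bigAnd k (fun i => F i.succ) fun i => h i.succ
    exact isFormula_binop _ (h 0).1 (h 0).2 ih.1 ih.2

/-- The iterated disjunction of clean formulas is a clean formula. [folklore] -/
theorem isFormula_bigOr : ∀ (k : ℕ) (F : Fin (k + 1) → Circuit ι),
    (∀ i, (F i).IsFormula ∧ ∀ m, (F i).output = .inr m → (F i).refCount m = 0) →
      (bigOr k F).IsFormula ∧ ∀ m, (bigOr k F).output = .inr m → (bigOr k F).refCount m = 0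
  | 0, _, h => h 0
  | k + 1, F, h => by
    have ih := isFormula_bigOr k (fun i => F i.succ) fun i => h i.succ
    exact isFormula_binop _ (h 0).1 (h 0).2 ih.1 ih.2

end Circuit

end Literature.Computability.Complexity
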